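import Mathlib
import Summits.ValiantsHypothesis.ValiantsHypothesis.Theorems.GrenetZeonPolySizeQPAlgebraCubeZero
import HarnessLib

/-!
# Crux `GrenetZeon.PolySizeQPAlgebra` (stmt-ValiantsHypothesis-8064), line `vbp-slice-dealg` —
# projections modulo `𝔪²` exist; the `𝔪³ = 0` local Hessian bound without data

`rank_hess0_transl_le_of_cube_zero` (`…CubeZero`) takes a `ℂ`-linear projection `π` modulo `(ker φ)²` as
data.  Over the field `ℂ` such a projection always exists with `dim range π = dim R - dim (ker φ)²`
(a linear complement), so the bound holds with the intrinsic threshold: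

* `exists_linearMap_sub_mem_and_finrank` — for every `ℂ`-submodule `W` of `R` there is a `ℂ`-linear
  `π : R → R` with `x - π x ∈ W` and `dim range π + dim W = dim R`.
* `rank_hess0_transl_le_of_cube_zero'` — **for every finite-dimensional commutative `ℂ`-algebra `R` with a
  character `φ`, `(ker φ)³ = 0`, `dim R ≥ 2`, every `n` with
  `6n + 9(dim R - dim (ker φ)²) + 2 ≤ 2·dim R·n + 18`, every `λ`, every affine `n × n` matrix `A`, every
  point `p` with `det A(p) = 0` in `R`: `rank Hess λ(det A)(p) ≤ 2·dim R·n`.**  For `ℂ[x,y]/(x²,y²)`: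
  all `n ≥ 6`.

HONEST FRAMING: a rank theorem for a class of coefficient algebras; no stub of the line is closed;
VP ≠ VNP is not moved.

References: T. Mignon, N. Ressayre, IMRN 2004:79, §2 [MignonRessayre2004].
-/

noncomputable section

open MvPolynomial Matrix
open Literature.Computability.AlgebraicComplexity

-- single-conjunct layout `Summits/ValiantsHypothesis/ValiantsHypothesis`: duplicated namespace by design
set_option linter.dupNamespace false

namespace Summit.ValiantsHypothesis.ValiantsHypothesis.Theorems.GrenetZeonPolySizeQPAlgebra

section Proj

variable {R : Type*} [CommRing R] [Algebra ℂ R] [Module.Finite ℂ R]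

/-- **Projections modulo a subspace.**  For a `ℂ`-submodule `W` of `R` there is a `ℂ`-linear `π` with
`x - π x ∈ W` for all `x` and `dim range π + dim W = dim R` (project onto a linear complement).
[folklore] -/
theorem exists_linearMap_sub_mem_and_finrank (W : Submodule ℂ R) :
    ∃ π : R →ₗ[ℂ] R, (∀ x, x - π x ∈ W) ∧
      Module.finrank ℂ (LinearMap.range π) + Module.finrank ℂ W = Module.finrank ℂ R := by
  obtain ⟨U, hUW⟩ := Submodule.exists_isCompl W
  set e := Submodule.prodEquivOfIsCompl W U hUW with he
  refine ⟨U.subtype ∘ₗ LinearMap.snd ℂ W U ∘ₗ e.symm.toLinearMap, fun x => ?_, ?_⟩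
  · have hsum : ∀ y : W × U, e y = (y.1 : R) + (y.2 : R) := fun y => by
      simp [he, Submodule.prodEquivOfIsCompl]
    have hx : x = ((e.symm x).1 : R) + ((e.symm x).2 : R) := by
      rw [← hsum, LinearEquiv.apply_symm_apply]
    simp only [LinearMap.coe_comp, Function.comp_apply, LinearEquiv.coe_coe, LinearMap.snd_apply,
      Submodule.coe_subtype]
    have h1 : x - ((e.symm x).2 : R) = ((e.symm x).1 : R) := by
      rw [sub_eq_iff_eq_add]; exact hx
    rw [h1]
    exact (e.symm x).1.2
  · have hr : LinearMap.range (U.subtype ∘ₗ LinearMap.snd ℂ W U ∘ₗ e.symm.toLinearMap) = U := by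
      rw [LinearMap.range_comp, LinearMap.range_comp, LinearEquiv.range, Submodule.map_top,
        LinearMap.range_eq_top.2 LinearMap.snd_surjective, Submodule.map_top, Submodule.range_subtype]
    rw [hr, add_comm]
    exact Submodule.finrank_add_eq_of_isCompl hUW

variable {σ : Type*} [Fintype σ] [DecidableEq σ]

/-- **`LocalHessianBound` for every local type with `𝔪³ = 0`, intrinsic threshold.**  As
`rank_hess0_transl_le_of_cube_zero`, with the projection modulo `(ker φ)²` supplied by
`exists_linearMap_sub_mem_and_finrank`. [cite: MignonRessayre2004, §2] -/
theorem rank_hess0_transl_le_of_cube_zero' {n : ℕ} (φ : R →ₐ[ℂ] ℂ)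
    (hker : RingHom.ker (φ : R →+* ℂ) ^ 3 = ⊥) (hR : 2 ≤ Module.finrank ℂ R)
    (hn : 6 * n + 9 * (Module.finrank ℂ R -
      Module.finrank ℂ ((RingHom.ker (φ : R →+* ℂ) ^ 2).restrictScalars ℂ)) + 2 ≤
      2 * Module.finrank ℂ R * n + 18)
    (l : R →ₗ[ℂ] ℂ) (A : Matrix (Fin n) (Fin n) (MvPolynomial σ R)) (F : MvPolynomial σ ℂ)
    (hA : ∀ a b, (A a b).totalDegree ≤ 1) (hF : ∀ d, l (coeff d A.det) = coeff d F) (p : σ → ℂ)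
    (hp : eval (fun i => algebraMap ℂ R (p i)) A.det = 0) :
    (hess0 (transl p F)).rank ≤ 2 * Module.finrank ℂ R * n := by
  obtain ⟨π, hπ, hd⟩ :=
    exists_linearMap_sub_mem_and_finrank ((RingHom.ker (φ : R →+* ℂ) ^ 2).restrictScalars ℂ)
  refine rank_hess0_transl_le_of_cube_zero φ hker hR π (fun x => ?_) (by omega) l A F hA hF p hp
  exact (Submodule.restrictScalars_mem ℂ _ _).1 (hπ x)

end Proj

end Summit.ValiantsHypothesis.ValiantsHypothesis.Theorems.GrenetZeonPolySizeQPAlgebra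

end
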